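import Summits.Parity.GeneralizedHardyLittlewood.Theorems.BeyondDiagonalBeatsQuarter.OffDiagHeartCoreTruncation
import Summits.Parity.GeneralizedHardyLittlewood.Theorems.BeyondDiagonalBeatsQuarter.OffDiagCoreRanges
import Summits.Parity.GeneralizedHardyLittlewood.Theorems.BeyondDiagonalBeatsQuarter.OffDiagMollifierSeparation
import HarnessLib

/-!
# Route `PrimeLevelFamEdge`, crux K_B (stmt-Parity-20343), line `diagonal_kernel_split` rev 4, plan Ω,
# L7d leaf **D3′ — `OffDiagCoreRangeThreshold`: every q-dependent range cut of the dual core is an UP-SET in the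
# level, hence ONE threshold `[y_x ≤ q]`, separated EXACTLY by the finite Fourier device** (L7D-PLAN §3, D3 → D3′
# ruling of the arbiter prover-6, 17:55:54Z)

For a cell index `x = (r, l, m, d₁, d₂, i, h₁)` of `offDiagCore (coreHeight ε₀)` the level `q` enters the RANGES through
`r < q⁷`, `l, m ≤ ⌊q̂(q)^{Δ′}⌋`, `i ∈ nearBoxes q d₁ d₂ (log q)⁴`, `|h₁| ≤ coreHeight ε₀ q …` — all monotone in `q`
(`OffDiagCoreRanges.range_pow_subset`, `floor_qhat_rpow_mono`, `nearBoxes_log_subset` (prover-7) and `coreHeight_mono` below).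
So on a window of levels `[1, P−1]` the conjunction `coreRange … q` is `[coreThreshold … P ≤ q]` for ONE threshold in
`[1, P]`, and `LevelSeparation.ite_le_eq_one_sub_sum_sepCoeff` (the tree's Vaughan-Lemma-2 device, `w = q`) separates it with
NO error term: the coefficient `sepCoeff P (y−1) k` joins the family weight (majorant `sepWeight P k`, `Σ_k ≤ 2 + log P`), the
twist `e(kq/P)` joins the universal level weight. No «margins» remain (D3 dissolved).

* `coreRange` (definition), `coreHeight_mono`, **`coreRange_mono`**;
* `coreThreshold` (definition: least level of `[1, P−1]` in the range, else `P`), `one_le_coreThreshold`, `coreThreshold_le`,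
  **`coreRange_iff_threshold_le`**;
* **`sum_ite_coreRange_eq_completed`** — `Σ_{q∈G}[coreRange … q]·F q = Σ_{q∈G} F q − Σ_{k<P} sepCoeff P (y−1) k · Σ_{q∈G} e(kq/P)·F q`
  for `G ⊆ [1, P−1]`; `norm_sepCoeff_coreThreshold_le` (the `sepWeight` majorant).

Two bookkeeping definitions (reviewed) + exact identities; helper; closes nothing; standard axioms.
«The programme SEARCHES and TYPES; no claim about Landau–Siegel zeros, Theorems 1–2 of arXiv:2211.02515 or
a repaired Margin232 until a kernel theorem says so.»
-/

noncomputable section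

open Finset
open scoped Real

namespace Summit.Parity.GeneralizedHardyLittlewood.Theorems.BeyondDiagonalBeatsQuarter.OffDiag

open Literature.NumberTheory.LFunctions Literature.NumberTheory.LFunctions.KMV2000
open Literature.NumberTheory.Sieve.LargeSieve (e sepCoeff sepWeight norm_sepCoeff_le)
open PeterssonSplit (nearBoxes)
open LevelSeparation (ite_le_eq_one_sub_sum_sepCoeff)

/-! ### §1. The range predicate and its monotonicity in the level -/

/-- **The range cut of the dual core at level `q`** for the cell index `(r, l, m, d₁, d₂, i, h₁)`: layer `r < q⁷`, mollifier
`l, m ≤ ⌊q̂(q)^{Δ′}⌋`, near box `i`, dual modulus `|h₁| ≤ coreHeight ε₀ q d₁ d₂ (l/d₁) (m/d₂) (r+1) i`.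
[cite: KowalskiMichelVanderKam2000, §6 p. 19 — derivation (bookkeeping predicate)] -/
def coreRange (Δ' ε₀ : ℝ) (r l m d₁ d₂ : ℕ) (i : ℕ × ℕ) (h₁ : ℤ) (q : ℕ) : Prop :=
  r < q ^ 7 ∧ l ≤ ⌊qhat q ^ Δ'⌋₊ ∧ m ≤ ⌊qhat q ^ Δ'⌋₊ ∧ i ∈ nearBoxes q d₁ d₂ (Real.log q ^ 4) ∧
    |h₁| ≤ (coreHeight ε₀ q d₁ d₂ (l / d₁) (m / d₂) (r + 1) i : ℤ)

/-- The real quantity under the ceiling of `coreHeight`, with `(qc)·(1 + A/(qc)) = qc + A` multiplied out. [folklore] -/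
theorem coreHeight_arg_eq (ε₀ : ℝ) {q c : ℕ} (hq : 1 ≤ q) (hc : 1 ≤ c) (α β : ℕ) (i : ℕ × ℕ) :
    ((q * c : ℕ) : ℝ) * ((1 + 4 * π * Real.sqrt ((α : ℝ) * β * (2 * 2 ^ i.2)) / ((q : ℝ) * (c : ℝ)) *
        Real.sqrt (2 * 2 ^ i.1)) / ((2 : ℝ) ^ i.1 / 2)) / (2 * π) * (q : ℝ) ^ ε₀ =
      (((q : ℝ) * c + 4 * π * Real.sqrt ((α : ℝ) * β * (2 * 2 ^ i.2)) * Real.sqrt (2 * 2 ^ i.1)) /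
          ((2 : ℝ) ^ i.1 / 2)) / (2 * π) * (q : ℝ) ^ ε₀ := by
  have hq0 : (q : ℝ) ≠ 0 := by exact_mod_cast (by omega : q ≠ 0)
  have hc0 : (c : ℝ) ≠ 0 := by exact_mod_cast (by omega : c ≠ 0)
  congr 2
  push_cast
  field_simp

/-- **The dual height is monotone in the level**: for `ε₀ ≥ 0`, `1 ≤ q ≤ q′` and `c ≥ 1`,
`coreHeight ε₀ q … c i ≤ coreHeight ε₀ q′ … c i`. [folklore] -/
theorem coreHeight_mono {ε₀ : ℝ} (hε₀ : 0 ≤ ε₀) {q q' : ℕ} (hq : 1 ≤ q) (h : q ≤ q') (d₁ d₂ α β : ℕ) {c : ℕ}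
    (hc : 1 ≤ c) (i : ℕ × ℕ) : coreHeight ε₀ q d₁ d₂ α β c i ≤ coreHeight ε₀ q' d₁ d₂ α β c i := by
  have hq' : 1 ≤ q' := le_trans hq h
  rw [coreHeight_apply, coreHeight_apply, coreHeight_arg_eq ε₀ hq hc, coreHeight_arg_eq ε₀ hq' hc]
  refine Nat.ceil_mono ?_
  set A : ℝ := 4 * π * Real.sqrt ((α : ℝ) * β * (2 * 2 ^ i.2)) * Real.sqrt (2 * 2 ^ i.1) with hA
  have hA0 : 0 ≤ A := by positivity
  have hqq : (q : ℝ) ≤ q' := by exact_mod_cast h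
  have hq1 : (1 : ℝ) ≤ q := by exact_mod_cast hq
  have hc0 : (0 : ℝ) ≤ c := Nat.cast_nonneg c
  have hf : ((q : ℝ) * c + A) / ((2 : ℝ) ^ i.1 / 2) / (2 * π) ≤ ((q' : ℝ) * c + A) / ((2 : ℝ) ^ i.1 / 2) / (2 * π) := by
    refine div_le_div_of_nonneg_right (div_le_div_of_nonneg_right ?_ (by positivity)) (by positivity)
    nlinarith
  have hg : (q : ℝ) ^ ε₀ ≤ (q' : ℝ) ^ ε₀ := Real.rpow_le_rpow (by positivity) hqq hε₀
  exact mul_le_mul hf hg (by positivity) (by positivity)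

/-- **The range cut is an up-set in the level**: `coreRange … q → coreRange … q′` for `1 ≤ q ≤ q′` (`Δ′, ε₀ ≥ 0`).
[folklore] -/
theorem coreRange_mono {Δ' ε₀ : ℝ} (hΔ : 0 ≤ Δ') (hε₀ : 0 ≤ ε₀) {q q' : ℕ} (hq : 1 ≤ q) (h : q ≤ q')
    {r l m d₁ d₂ : ℕ} {i : ℕ × ℕ} {h₁ : ℤ} :
    coreRange Δ' ε₀ r l m d₁ d₂ i h₁ q → coreRange Δ' ε₀ r l m d₁ d₂ i h₁ q' := by
  rintro ⟨hr, hl, hm, hi, hh⟩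
  refine ⟨lt_of_lt_of_le hr (Nat.pow_le_pow_left h 7), hl.trans (floor_qhat_rpow_mono h hΔ),
    hm.trans (floor_qhat_rpow_mono h hΔ), nearBoxes_log_subset hq h d₁ d₂ hi, hh.trans ?_⟩
  exact_mod_cast coreHeight_mono hε₀ hq h d₁ d₂ (l / d₁) (m / d₂) (by omega : 1 ≤ r + 1) i

/-! ### §2. The threshold -/

open Classical in
/-- **The level threshold** of the cell index on the window `[1, P−1]`: the least level in the range, or `P` if none.
[cite: KowalskiMichelVanderKam2000, §6 p. 19 — derivation (bookkeeping)] -/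
def coreThreshold (Δ' ε₀ : ℝ) (r l m d₁ d₂ : ℕ) (i : ℕ × ℕ) (h₁ : ℤ) (P : ℕ) : ℕ :=
  if h : ((Finset.Icc 1 (P - 1)).filter (fun q => coreRange Δ' ε₀ r l m d₁ d₂ i h₁ q)).Nonempty then
    ((Finset.Icc 1 (P - 1)).filter (fun q => coreRange Δ' ε₀ r l m d₁ d₂ i h₁ q)).min' h
  else P

section Threshold

variable {Δ' ε₀ : ℝ} {r l m d₁ d₂ : ℕ} {i : ℕ × ℕ} {h₁ : ℤ} {P : ℕ}

open Classical in
/-- In the nonempty case the threshold lies in the window and in the range. [folklore] -/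
theorem coreThreshold_mem (h : ((Finset.Icc 1 (P - 1)).filter (fun q => coreRange Δ' ε₀ r l m d₁ d₂ i h₁ q)).Nonempty) :
    coreThreshold Δ' ε₀ r l m d₁ d₂ i h₁ P ∈
      (Finset.Icc 1 (P - 1)).filter (fun q => coreRange Δ' ε₀ r l m d₁ d₂ i h₁ q) := by
  rw [coreThreshold, dif_pos h]
  exact Finset.min'_mem _ h

/-- `1 ≤ coreThreshold … P` for `P ≥ 1`. [folklore] -/
theorem one_le_coreThreshold (hP : 1 ≤ P) : 1 ≤ coreThreshold Δ' ε₀ r l m d₁ d₂ i h₁ P := by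
  classical
  by_cases h : ((Finset.Icc 1 (P - 1)).filter (fun q => coreRange Δ' ε₀ r l m d₁ d₂ i h₁ q)).Nonempty
  · have hmem := coreThreshold_mem h
    exact (Finset.mem_Icc.1 (Finset.mem_filter.1 hmem).1).1
  · rw [coreThreshold, dif_neg h]
    exact hP

/-- `coreThreshold … P ≤ P`. [folklore] -/
theorem coreThreshold_le : coreThreshold Δ' ε₀ r l m d₁ d₂ i h₁ P ≤ P := by
  classical
  by_cases h : ((Finset.Icc 1 (P - 1)).filter (fun q => coreRange Δ' ε₀ r l m d₁ d₂ i h₁ q)).Nonempty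
  · have hmem := coreThreshold_mem h
    have := (Finset.mem_Icc.1 (Finset.mem_filter.1 hmem).1).2
    omega
  · rw [coreThreshold, dif_neg h]

/-- **The range cut is the threshold cut on the window**: for `q ∈ [1, P−1]` (`Δ′, ε₀ ≥ 0`),
`coreRange … q ↔ coreThreshold … P ≤ q`. [folklore] -/
theorem coreRange_iff_threshold_le (hΔ : 0 ≤ Δ') (hε₀ : 0 ≤ ε₀) {q : ℕ} (hq : q ∈ Finset.Icc 1 (P - 1)) :
    coreRange Δ' ε₀ r l m d₁ d₂ i h₁ q ↔ coreThreshold Δ' ε₀ r l m d₁ d₂ i h₁ P ≤ q := by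
  classical
  constructor
  · intro hR
    have hmem : q ∈ (Finset.Icc 1 (P - 1)).filter (fun q => coreRange Δ' ε₀ r l m d₁ d₂ i h₁ q) :=
      Finset.mem_filter.2 ⟨hq, hR⟩
    have hne : ((Finset.Icc 1 (P - 1)).filter (fun q => coreRange Δ' ε₀ r l m d₁ d₂ i h₁ q)).Nonempty := ⟨q, hmem⟩
    rw [coreThreshold, dif_pos hne]
    exact Finset.min'_le _ _ hmem
  · intro hle
    by_cases hne : ((Finset.Icc 1 (P - 1)).filter (fun q => coreRange Δ' ε₀ r l m d₁ d₂ i h₁ q)).Nonempty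
    · have hmem := coreThreshold_mem hne
      obtain ⟨hy, hRy⟩ := Finset.mem_filter.1 hmem
      exact coreRange_mono hΔ hε₀ (Finset.mem_Icc.1 hy).1 hle hRy
    · -- empty range: threshold `= P ≤ q ≤ P − 1` is impossible
      rw [coreThreshold, dif_neg hne] at hle
      have h1 := (Finset.mem_Icc.1 hq).1
      have h2 := (Finset.mem_Icc.1 hq).2
      omega

/-- The majorant of the separating coefficients at the threshold: `‖sepCoeff P (y−1) k‖ ≤ sepWeight P k` (`k < P`).
[cite: Vaughan1980, Lemma 2 — derivation] -/
theorem norm_sepCoeff_coreThreshold_le (hP : 1 ≤ P) {k : ℕ} (hk : k < P) :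
    ‖sepCoeff P (coreThreshold Δ' ε₀ r l m d₁ d₂ i h₁ P - 1) k‖ ≤ sepWeight P k := by
  refine norm_sepCoeff_le hk ?_
  have h1 := one_le_coreThreshold (Δ' := Δ') (ε₀ := ε₀) (r := r) (l := l) (m := m) (d₁ := d₁) (d₂ := d₂) (i := i)
    (h₁ := h₁) hP
  have h2 := coreThreshold_le (Δ' := Δ') (ε₀ := ε₀) (r := r) (l := l) (m := m) (d₁ := d₁) (d₂ := d₂) (i := i)
    (h₁ := h₁) (P := P)
  omega

/-! ### §3. The exact separation of the range cut across a block of levels -/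

open Classical in
/-- **The range cut, completed**: for a set of levels `G ⊆ [1, P−1]` and any level weight `F` (`Δ′, ε₀ ≥ 0`),
`Σ_{q∈G} [coreRange … q]·F q = Σ_{q∈G} F q − Σ_{k<P} sepCoeff P (y−1) k · Σ_{q∈G} e(k·q/P)·F q`, `y = coreThreshold … P`:
the threshold sits in the coefficients (majorant `sepWeight P k`, `Σ_k ≤ 2 + log P` by `LargeSieve.sum_sepWeight_le`),
the level only in the unimodular twist `e(kq/P)`. [cite: Vaughan1980, Lemma 2 — derivation] -/
theorem sum_ite_coreRange_eq_completed (hΔ : 0 ≤ Δ') (hε₀ : 0 ≤ ε₀) (G : Finset ℕ) (hG : G ⊆ Finset.Icc 1 (P - 1))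
    (F : ℕ → ℂ) :
    ∑ q ∈ G, (if coreRange Δ' ε₀ r l m d₁ d₂ i h₁ q then F q else 0) =
      ∑ q ∈ G, F q -
        ∑ k ∈ Finset.range P, sepCoeff P (coreThreshold Δ' ε₀ r l m d₁ d₂ i h₁ P - 1) k *
          ∑ q ∈ G, e ((k : ℝ) * q / P) * F q := by
  set y := coreThreshold Δ' ε₀ r l m d₁ d₂ i h₁ P with hy
  -- pointwise: the range cut is the threshold cut, then the finite Fourier expansion
  have hpt : ∀ q ∈ G, (if coreRange Δ' ε₀ r l m d₁ d₂ i h₁ q then F q else 0) =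
      F q - ∑ k ∈ Finset.range P, sepCoeff P (y - 1) k * (e ((k : ℝ) * q / P) * F q) := by
    intro q hqG
    have hq := hG hqG
    have hqP : q < P := by have := (Finset.mem_Icc.1 hq).2; have := (Finset.mem_Icc.1 hq).1; omega
    have hP : 1 ≤ P := by omega
    rw [show (if coreRange Δ' ε₀ r l m d₁ d₂ i h₁ q then F q else 0) =
        (if y ≤ q then (1 : ℂ) else 0) * F q by
      by_cases hR : coreRange Δ' ε₀ r l m d₁ d₂ i h₁ q
      · rw [if_pos hR, if_pos ((coreRange_iff_threshold_le hΔ hε₀ hq).1 hR), one_mul]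
      · rw [if_neg hR, if_neg (fun h => hR ((coreRange_iff_threshold_le hΔ hε₀ hq).2 h)), zero_mul]]
    rw [ite_le_eq_one_sub_sum_sepCoeff hqP (one_le_coreThreshold hP) coreThreshold_le, sub_mul, one_mul,
      Finset.sum_mul]
    refine congrArg _ (Finset.sum_congr rfl fun k _ => by ring)
  rw [Finset.sum_congr rfl hpt, Finset.sum_sub_distrib, Finset.sum_comm]
  simp only [Finset.mul_sum]

end Threshold

end Summit.Parity.GeneralizedHardyLittlewood.Theorems.BeyondDiagonalBeatsQuarter.OffDiag

end
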